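import Literature.Barriers.Schanuel.NesterenkoModularScopeProp36Unmixed
import Literature.Barriers.Schanuel.NesterenkoModularScopeDeepPrimes
import Literature.Barriers.Schanuel.NesterenkoModularScopeInduction
import Literature.NumberTheory.Transcendental.RoySmallValueFactors
import Mathlib.Algebra.Module.Submodule.Union
import HarnessLib

/-!
# Barrier (Schanuel) `NesterenkoModularScope`: towards Proposition 3.6 of LNM 1752 Ch. 10 (projectivised), III — the lemmas of the chain

Proofs-only sibling of `NesterenkoModularScope*.lean`; no definitions, nothing asserted.

LNM 1752 Ch. 10, proof of Prop. 3.6 (pp. 157–160), in the projectivised constant-free setting of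
`NesterenkoModularScopeInduction.lean` (`m = 4`, `x₁ = z`, the derivation `T = homT ℚ` of
`NesterenkoModularScopeDeepPrimes.lean`, orders `ordAlongQ` along `ω̄(z) = (1, z, P, Q, R)`):

* the ideals `J_c = (T^j E : j < c)` and the Leibniz rule `T^k J_c ⊆ J_{c+k}`;
* generic rational combinations avoiding finitely many primes;
* **(65)** — the exponents of the primary components of the chain ideal `𝔲_n` are `≤ 2λ a_n`
  (from Prop. 4.7 (1) `∑ k_j deg 𝔮_j = deg 𝔲_n` and the small-degree-element hypothesis `hSDE`
  (= LNM Ch. 10 Cor. 3.3) applied to a component of small degree, against the minimality of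
  `L = deg E`);
* **the `T`-step** — for every associated prime `𝔮` of `𝔲_n` some `T^j E_i ∉ 𝔮`, `j ≤ 2λ a_n`
  (Leibniz: `T^l(G^l H) ≡ l! (TG)^l H`, `NesterenkoModularScopeCh10Prelim`; then `T𝔮 ⊆ 𝔮`
  contradicts Lemma 3.4 = `Transfer.not_homTStable_of_deep`).

## References

* [NesterenkoPhilippon2001] Yu. V. Nesterenko, P. Philippon (eds.), *Introduction to Algebraic
  Independence Theory*, LNM 1752, Springer 2001, Ch. 10 §3, proof of Prop. 3.6 (pp. 157–160).
* [Nesterenko1996] Yu. V. Nesterenko, *Modular functions and transcendence questions*,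
  Sb. Math. 187 (1996) 1319–1348, §§5–6.
-/

noncomputable section

open Complex MvPolynomial Filter Topology
open Literature.NumberTheory.Transcendental Literature.NumberTheory.Transcendental.Nesterenko

attribute [local instance] MvPolynomial.gradedAlgebra

namespace Literature.Barriers.Schanuel

namespace Transfer

/-! ### The ideals `J_c = (T^j E : j < c)` -/

section JIdeals

variable {R A : Type*} [CommSemiring R] [CommRing A] [Algebra R A] (D : Derivation R A A) (E : A)

/-- `T^j E ∈ J_c` for `j < c`. [folklore] -/
theorem iterate_mem_span_image_Iio {j c : ℕ} (hj : j < c) :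
    D^[j] E ∈ Ideal.span ((fun j : ℕ => D^[j] E) '' Set.Iio c) :=
  Ideal.subset_span ⟨j, hj, rfl⟩

/-- `J_c ⊆ J_{c'}` for `c ≤ c'`. [folklore] -/
theorem span_image_Iio_mono {c c' : ℕ} (h : c ≤ c') :
    Ideal.span ((fun j : ℕ => D^[j] E) '' Set.Iio c) ≤ Ideal.span ((fun j : ℕ => D^[j] E) '' Set.Iio c') :=
  Ideal.span_mono (Set.image_mono fun _ hj => lt_of_lt_of_le hj h)

/-- **Leibniz**: `T J_c ⊆ J_{c+1}`. [cite: NesterenkoPhilippon2001, Ch. 10 proof of Prop. 3.6 (p. 159)] -/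
theorem apply_mem_span_image_Iio_succ {c : ℕ} {x : A}
    (hx : x ∈ Ideal.span ((fun j : ℕ => D^[j] E) '' Set.Iio c)) :
    D x ∈ Ideal.span ((fun j : ℕ => D^[j] E) '' Set.Iio (c + 1)) := by
  refine Submodule.span_induction (p := fun x _ =>
    D x ∈ Ideal.span ((fun j : ℕ => D^[j] E) '' Set.Iio (c + 1))) ?_ ?_ ?_ ?_ hx
  · rintro _ ⟨j, hj, rfl⟩
    have : D (D^[j] E) = D^[j + 1] E := (Function.iterate_succ_apply' D j E).symm
    rw [this]
    exact iterate_mem_span_image_Iio D E (by simpa using hj)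
  · rw [map_zero]; exact Submodule.zero_mem _
  · intro x y _ _ hx hy
    rw [map_add]; exact Ideal.add_mem _ hx hy
  · intro r x hxm hx
    rw [smul_eq_mul, Derivation.leibniz, smul_eq_mul, smul_eq_mul]
    refine Ideal.add_mem _ (Ideal.mul_mem_left _ _ hx) (Ideal.mul_mem_right _ _ ?_)
    exact span_image_Iio_mono D E (Nat.le_succ c) hxm

/-- `T^k J_c ⊆ J_{c+k}`. [cite: NesterenkoPhilippon2001, Ch. 10 proof of Prop. 3.6 (p. 159)] -/
theorem iterate_apply_mem_span_image_Iio {c : ℕ} {x : A}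
    (hx : x ∈ Ideal.span ((fun j : ℕ => D^[j] E) '' Set.Iio c)) (k : ℕ) :
    D^[k] x ∈ Ideal.span ((fun j : ℕ => D^[j] E) '' Set.Iio (c + k)) := by
  induction k with
  | zero => simpa using hx
  | succ k ih =>
    rw [Function.iterate_succ_apply', ← add_assoc]
    exact apply_mem_span_image_Iio_succ D E ih

/-- `J_c ≤ 𝔭` iff `T^j E ∈ 𝔭` for all `j < c`. [folklore] -/
theorem span_image_Iio_le_iff {c : ℕ} {P : Ideal A} :
    Ideal.span ((fun j : ℕ => D^[j] E) '' Set.Iio c) ≤ P ↔ ∀ j < c, D^[j] E ∈ P := by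
  rw [Ideal.span_le, Set.image_subset_iff]
  exact ⟨fun h j hj => h hj, fun h j hj => h j hj⟩

end JIdeals

/-! ### Generic rational combinations -/

section Avoid

variable {A : Type*} [CommRing A] [Algebra ℚ A]

/-- **Avoiding finitely many primes by a rational combination**: if `z_v ∉ 𝔮_v` for each `v`
(finitely many ideals `𝔮_v`, prime or not), some `ℚ`-linear combination `∑ η_v z_v` lies outside
every `𝔮_w` — the `η` with `∑ η_v z_v ∈ 𝔮_w` form a proper subspace of `ℚ^V`, and `ℚ^V` is not a
finite union of proper subspaces. [cite: NesterenkoPhilippon2001, Ch. 10 proof of Prop. 3.6 (p. 159)] -/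
theorem exists_rat_combination_notMem {ι : Type*} [Fintype ι] (z : ι → A) (𝔮 : ι → Ideal A)
    (hz : ∀ v, z v ∉ 𝔮 v) : ∃ η : ι → ℚ, ∀ w, (∑ v, η v • z v) ∉ 𝔮 w := by
  classical
  let Φ : (ι → ℚ) →ₗ[ℚ] A :=
    { toFun := fun η => ∑ v, η v • z v
      map_add' := fun η η' => by
        simp only [Pi.add_apply, add_smul, Finset.sum_add_distrib]
      map_smul' := fun c η => by
        simp only [Pi.smul_apply, smul_eq_mul, RingHom.id_apply, Finset.smul_sum, mul_smul] }
  let p : ι → Submodule ℚ (ι → ℚ) := fun w => ((𝔮 w).restrictScalars ℚ).comap Φ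
  have hp : ∀ w, p w ≠ ⊤ := by
    intro w htop
    have hmem : (Pi.single w 1 : ι → ℚ) ∈ p w := by rw [htop]; exact Submodule.mem_top
    have hΦ : Φ (Pi.single w 1) = z w := by
      change ∑ v, (Pi.single w 1 : ι → ℚ) v • z v = z w
      rw [Finset.sum_eq_single w]
      · simp
      · intro v _ hvw
        rw [Pi.single_eq_of_ne hvw, zero_smul]
      · intro h; exact absurd (Finset.mem_univ w) h
    have : z w ∈ 𝔮 w := by
      have h := hmem
      change Φ (Pi.single w 1) ∈ (𝔮 w).restrictScalars ℚ at h
      rwa [hΦ] at h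
    exact hz w this
  obtain ⟨η, hη⟩ := Submodule.exists_forall_notMem_of_forall_ne_top p hp
  exact ⟨η, fun w h => hη w h⟩

end Avoid

/-! ### Minimal forms of a prime are irreducible -/

section MinimalForm

/-- A non-zero form of degree `0` is a unit. [folklore] -/
theorem isUnit_of_isHomogeneous_zero' {G : Rx 4} (hG : G.IsHomogeneous 0) (h0 : G ≠ 0) : IsUnit G := by
  have hdeg : G.totalDegree = 0 := hG.totalDegree h0
  rw [totalDegree_eq_zero_iff_eq_C] at hdeg
  rw [hdeg]
  refine (isUnit_iff_ne_zero.mpr ?_).map C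
  intro hc
  apply h0
  rw [hdeg, hc, C_0]

/-- **A form of minimal degree in a prime ideal generates a prime ideal** ("the polynomial `E` is
obviously irreducible", LNM 1752 Ch. 10 p. 157): its divisors are forms (`isHomogeneous_of_dvd`),
one of any two complementary divisors lies in `𝔭` and so has the full degree, and the other is a
unit. [cite: NesterenkoPhilippon2001, Ch. 10 proof of Prop. 3.6 (p. 157)] -/
theorem isPrime_span_of_minimal {𝔭 : Ideal (Rx 4)} (hprime : 𝔭.IsPrime) {E : Rx 4} {L : ℕ}
    (hE𝔭 : E ∈ 𝔭) (hEhom : E.IsHomogeneous L) (hE0 : E ≠ 0)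
    (hLmin : ∀ P ∈ 𝔭, ∀ e : ℕ, P.IsHomogeneous e → P ≠ 0 → L ≤ e) :
    (Ideal.span {E}).IsPrime := by
  rw [Ideal.span_singleton_prime hE0, ← irreducible_iff_prime]
  refine ⟨fun hu => hprime.ne_top (Ideal.eq_top_of_isUnit_mem _ hE𝔭 hu), fun a b hab => ?_⟩
  have ha0 : a ≠ 0 := by rintro rfl; exact hE0 (by rw [hab, zero_mul])
  have hb0 : b ≠ 0 := by rintro rfl; exact hE0 (by rw [hab, mul_zero])
  have hahom : a.IsHomogeneous a.totalDegree :=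
    Roy2013.isHomogeneous_of_dvd hEhom hE0 ⟨b, hab⟩
  have hbhom : b.IsHomogeneous b.totalDegree :=
    Roy2013.isHomogeneous_of_dvd hEhom hE0 ⟨a, by rw [hab, mul_comm]⟩
  have hsum : a.totalDegree + b.totalDegree = L := by
    have h1 : E.IsHomogeneous (a.totalDegree + b.totalDegree) := by rw [hab]; exact hahom.mul hbhom
    exact (h1.inj_right hEhom hE0)
  rcases hprime.mem_or_mem (show a * b ∈ 𝔭 by rw [← hab]; exact hE𝔭) with ha | hb
  · have hLa := hLmin a ha _ hahom ha0
    have hb00 : b.totalDegree = 0 := by omega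
    rw [hb00] at hbhom
    exact Or.inr (isUnit_of_isHomogeneous_zero' hbhom hb0)
  · have hLb := hLmin b hb _ hbhom hb0
    have ha00 : a.totalDegree = 0 := by omega
    rw [ha00] at hahom
    exact Or.inl (isUnit_of_isHomogeneous_zero' hahom ha0)

/-- **A non-zero homogeneous prime has a form of minimal degree**, which is `≥ 1`. [folklore] -/
theorem exists_minimal_form {𝔭 : Ideal (Rx 4)} (hprime : 𝔭.IsPrime)
    (hhom : 𝔭.IsHomogeneous (homogeneousSubmodule (Fin 5) ℚ)) (hne : 𝔭 ≠ ⊥) :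
    ∃ (E : Rx 4) (L : ℕ), E ∈ 𝔭 ∧ E.IsHomogeneous L ∧ E ≠ 0 ∧ 1 ≤ L ∧
      ∀ P ∈ 𝔭, ∀ e : ℕ, P.IsHomogeneous e → P ≠ 0 → L ≤ e := by
  classical
  have hex : ∃ L : ℕ, ∃ E ∈ 𝔭, E.IsHomogeneous L ∧ E ≠ 0 := by
    obtain ⟨g, hg, n, hn, h0⟩ := exists_homogeneous_mem_ne_zero hhom hne
    exact ⟨n, g, hg, hn, h0⟩
  refine ⟨(Nat.find_spec hex).choose, Nat.find hex, (Nat.find_spec hex).choose_spec.1,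
    (Nat.find_spec hex).choose_spec.2.1, (Nat.find_spec hex).choose_spec.2.2, ?_, ?_⟩
  · by_contra hL
    have hL0 : Nat.find hex = 0 := by omega
    obtain ⟨E, hE, hEhom, hE0⟩ := Nat.find_spec hex
    rw [hL0] at hEhom
    exact hprime.ne_top (Ideal.eq_top_of_isUnit_mem _ hE (isUnit_of_isHomogeneous_zero' hEhom hE0))
  · intro P hP e he hP0
    exact Nat.find_min' hex ⟨P, hP, he, hP0⟩

end MinimalForm

/-! ### (65): the exponents of the components of the chain ideal are small -/

section Exponents

/-- **Inequality (65) of LNM 1752 Ch. 10** (p. 159): let `𝔲` be a homogeneous unmixed ideal of rank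
`ρ ∈ {2, 3, 4}` all of whose associated primes lie inside the prime `𝔭`, with
`deg 𝔲 ≤ a (L+1)^{5−ρ}`, where `L` is the least degree of a non-zero form of `𝔭`; then every
primary component of `𝔲` has exponent `≤ 2λ a` — by Prop. 4.7 (1) `∑ k_j deg 𝔮_j = deg 𝔲`, a
component with `k_j > 2λ a` has `deg 𝔮_j < (L+1)^{5−ρ}/(2λ)`, so (Cor. 3.3, here the hypothesis
`hSDE`) `𝔮_j ⊆ 𝔭` contains a non-zero form of degree `≤ L − 1`, contradicting the minimality of `L`
(if `(L+1)^{5−ρ} ≤ 2λ` the bound is immediate).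
[cite: NesterenkoPhilippon2001, Ch. 10 proof of Prop. 3.6, (65) (p. 159)] -/
theorem primaryExponent_le_of_minimal {γ₂ lam : ℕ} (hlam16 : 16 ≤ lam) (hlamγ : γ₂ * 3 ^ 5 ≤ 2 * lam)
    (hSDE : ∀ ρ : ℕ, 2 ≤ ρ → ρ ≤ 4 → ∀ 𝔮 : Ideal (Rx 4), 𝔮.IsPrime →
      𝔮.IsHomogeneous (homogeneousSubmodule (Fin 5) ℚ) → IsUnmixedOfRank 𝔮 ρ →
      ∀ ν : ℕ, 1 ≤ ν → γ₂ * ideg 𝔮 ρ ≤ ν ^ (5 - ρ) →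
      ∃ P ∈ 𝔮, ∃ e : ℕ, P.IsHomogeneous e ∧ P ≠ 0 ∧ 1 ≤ e ∧ e ≤ ν)
    {𝔭 : Ideal (Rx 4)} {L : ℕ} (hLmin : ∀ P ∈ 𝔭, ∀ e : ℕ, P.IsHomogeneous e → P ≠ 0 → L ≤ e)
    {ρ : ℕ} (hρ2 : 2 ≤ ρ) (hρ4 : ρ ≤ 4) {u : Ideal (Rx 4)}
    (huhom : u.IsHomogeneous (homogeneousSubmodule (Fin 5) ℚ)) (hunm : IsUnmixedOfRank u ρ)
    (hu𝔭 : ∀ P ∈ u.associatedPrimes, P ≤ 𝔭)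
    {t : Finset (Ideal (Rx 4))} (ht : Submodule.IsMinimalPrimaryDecomposition u t)
    {an : ℕ} (han : 1 ≤ an) (hideg : ideg u ρ ≤ an * (L + 1) ^ (5 - ρ))
    {Q : Ideal (Rx 4)} (hQ : Q ∈ t) : primaryExponent Q ≤ 2 * lam * an := by
  classical
  set q := Q.radical with hq
  have hq_ass : q ∈ u.associatedPrimes := by
    have h := ht.mem_associatedPrimes hQ
    rwa [Submodule.colon_univ] at h
  have hqprime : q.IsPrime := Ideal.isPrime_radical (ht.primary hQ)
  have hqhom : q.IsHomogeneous (homogeneousSubmodule (Fin 5) ℚ) :=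
    Literature.RingTheory.GradedAlgebra.isHomogeneous_of_mem_associatedPrimes
      (homogeneousSubmodule (Fin 5) ℚ) huhom hq_ass
  have hqunm : IsUnmixedOfRank q ρ := isUnmixedOfRank_of_isPrime hqprime (hunm.2 q hq_ass)
  have hq𝔭 : q ≤ 𝔭 := hu𝔭 q hq_ass
  have hρ1 : 1 ≤ ρ := by omega
  have hdeg1 : 1 ≤ ideg q ρ :=
    one_le_ideg_of_isPrime NesterenkoPhilippon2001_ch3_prop_4_4_holds hρ1 hρ4 hqprime hqhom hqunm
  -- Proposition 4.7 (1)
  have h47 := (NesterenkoPhilippon2001_ch3_prop_4_7_holds 4 ρ u hρ1 hρ4 huhom hunm t ht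
    (fun _ => 1) (fun h => one_ne_zero (congr_fun h 0))).1
  have hkle : primaryExponent Q * ideg q ρ ≤ ideg u ρ := by
    rw [← h47]
    exact Finset.single_le_sum (f := fun Q' => primaryExponent Q' * ideg Q'.radical ρ)
      (fun _ _ => Nat.zero_le _) hQ
  set k := primaryExponent Q with hk
  set c := 5 - ρ with hc
  have hc3 : c ≤ 3 := by omega
  by_cases hcase : (L + 1) ^ c ≤ 2 * lam
  · calc k ≤ k * ideg q ρ := Nat.le_mul_of_pos_right k hdeg1
      _ ≤ ideg u ρ := hkle
      _ ≤ an * (L + 1) ^ c := hideg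
      _ ≤ an * (2 * lam) := Nat.mul_le_mul_left an hcase
      _ = 2 * lam * an := by ring
  · push Not at hcase
    have hL2 : 2 ≤ L := by
      by_contra hL
      have hL1 : L + 1 ≤ 2 := by omega
      have h8 : (L + 1) ^ c ≤ 2 ^ 3 :=
        (Nat.pow_le_pow_left hL1 c).trans (Nat.pow_le_pow_right (by norm_num) hc3)
      omega
    by_contra hkK
    push Not at hkK
    have h1 : (2 * lam * an + 1) * ideg q ρ ≤ an * (L + 1) ^ c :=
      calc (2 * lam * an + 1) * ideg q ρ ≤ k * ideg q ρ := Nat.mul_le_mul_right _ hkK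
        _ ≤ ideg u ρ := hkle
        _ ≤ an * (L + 1) ^ c := hideg
    have h2 : (L + 1) ^ c ≤ 3 ^ c * (L - 1) ^ c := by
      rw [← mul_pow]
      exact Nat.pow_le_pow_left (by omega) c
    have h3 : γ₂ * ideg q ρ ≤ (L - 1) ^ c := by
      by_contra h4
      push Not at h4
      have h5 : 2 * lam * an * ((L - 1) ^ c + 1) ≤ 2 * lam * an * (L - 1) ^ c :=
        calc 2 * lam * an * ((L - 1) ^ c + 1) ≤ 2 * lam * an * (γ₂ * ideg q ρ) :=
              Nat.mul_le_mul_left _ h4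
          _ ≤ γ₂ * ((2 * lam * an + 1) * ideg q ρ) := by
              have : γ₂ * ((2 * lam * an + 1) * ideg q ρ) =
                  2 * lam * an * (γ₂ * ideg q ρ) + γ₂ * ideg q ρ := by ring
              rw [this]
              exact Nat.le_add_right _ _
          _ ≤ γ₂ * (an * (L + 1) ^ c) := Nat.mul_le_mul_left _ h1
          _ ≤ γ₂ * (an * (3 ^ c * (L - 1) ^ c)) :=
              Nat.mul_le_mul_left _ (Nat.mul_le_mul_left _ h2)
          _ = (γ₂ * 3 ^ c) * an * (L - 1) ^ c := by ring
          _ ≤ (γ₂ * 3 ^ 5) * an * (L - 1) ^ c := by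
              gcongr
              · norm_num
              · omega
          _ ≤ (2 * lam) * an * (L - 1) ^ c := by gcongr
          _ = 2 * lam * an * (L - 1) ^ c := by ring
      have hpos : 0 < 2 * lam * an := by positivity
      rw [Nat.mul_add, mul_one] at h5
      omega
    obtain ⟨P, hPq, e, hPhom, hP0, he1, heL⟩ :=
      hSDE ρ hρ2 hρ4 q hqprime hqhom hqunm (L - 1) (by omega) h3
    have := hLmin P (hq𝔭 hPq) e hPhom hP0
    omega

end Exponents

/-! ### The `T`-step: some `T^j E_i` escapes each associated prime -/

section TStep

/-- **The `T`-step of the proof of Prop. 3.6** (LNM 1752 Ch. 10 p. 159): let `𝔭` be a deep prime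
(Lemma 3.4 applies), `E₀, …, E_n ∈ 𝔭` forms with the avoidance property (so that the associated
primes of `𝔲_n = (E₀, …, E_n)_𝔭` are the minimal primes `⊆ 𝔭` of `(E₀, …, E_n)`), `K` a bound for
the exponents of the primary components of `𝔲_n`. Then for every component `Q`, some `T^j E_i`,
`j ≤ K`, lies outside `𝔮 = √Q`: otherwise `T^l 𝔞_n ⊆ 𝔮` (`l` the exponent of `Q`, Leibniz), and
with `H ∉ 𝔮`, `G^l H ∈ 𝔞_n` for all `G ∈ 𝔮` (`H` = a uniform denominator of `𝔲_n` times elements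
of the other components) one gets `T𝔮 ⊆ 𝔮` (`T^l(G^l H) ≡ l! (TG)^l H`), contradicting Lemma 3.4
(`not_homTStable_of_deep`). [cite: NesterenkoPhilippon2001, Ch. 10 proof of Prop. 3.6 (p. 159)] -/
theorem exists_iterate_homT_notMem {r : ℕ} (hr1 : 1 ≤ r) (hr4 : r ≤ 4) {𝔭 : Ideal (Rx 4)}
    (hprime : 𝔭.IsPrime) (hhom : 𝔭.IsHomogeneous (homogeneousSubmodule (Fin 5) ℚ))
    (hunm𝔭 : IsUnmixedOfRank 𝔭 r) (hdeep : ((3 * r * ideg 𝔭 r : ℕ) : ℕ∞) ≤ ordI 𝔭 r)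
    {Es : List (Rx 4)} (hEs𝔭 : ∀ x ∈ Es, x ∈ 𝔭)
    (hav : ∀ (L₁ : List (Rx 4)) (y : Rx 4) (L₂ : List (Rx 4)), Es = L₁ ++ y :: L₂ →
      ∀ 𝔭' ∈ (Ideal.ofList L₁).minimalPrimes, 𝔭' ≤ 𝔭 → y ∉ 𝔭')
    (hE0 : ∃ x ∈ Es, x ≠ 0) (hEshom : ∀ x ∈ Es, ∃ e : ℕ, x.IsHomogeneous e)
    {t : Finset (Ideal (Rx 4))}
    (ht : Submodule.IsMinimalPrimaryDecomposition (locP 𝔭 hprime (Ideal.ofList Es)) t)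
    {K : ℕ} (hK : ∀ Q ∈ t, primaryExponent Q ≤ K) {Q : Ideal (Rx 4)} (hQ : Q ∈ t) :
    ∃ x ∈ Es, ∃ j ≤ K, (homT ℚ)^[j] x ∉ Q.radical := by
  classical
  obtain ⟨hunm, hass⟩ := isUnmixedOfRank_locP_ofList hprime hEs𝔭 hav
  set q := Q.radical with hq
  have hq_ass : q ∈ (locP 𝔭 hprime (Ideal.ofList Es)).associatedPrimes := by
    have h := ht.mem_associatedPrimes hQ
    rwa [Submodule.colon_univ] at h
  obtain ⟨hqmin, hq𝔭⟩ := (hass q).mp hq_ass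
  have hqprime : q.IsPrime := hqmin.1.1
  have haq : Ideal.ofList Es ≤ q := hqmin.1.2
  have hahom : (Ideal.ofList Es).IsHomogeneous (homogeneousSubmodule (Fin 5) ℚ) :=
    Ideal.homogeneous_span _ _ fun x hx => by
      obtain ⟨e, he⟩ := hEshom x hx
      exact ⟨e, (mem_homogeneousSubmodule e x).mpr he⟩
  have hqhom : q.IsHomogeneous (homogeneousSubmodule (Fin 5) ℚ) :=
    Literature.RingTheory.MvPolynomial.isHomogeneous_of_mem_minimalPrimes hahom hqmin
  have hqne : q ≠ ⊥ := by
    obtain ⟨x, hx, hx0⟩ := hE0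
    intro h
    have : x ∈ q := haq (Ideal.subset_span hx)
    rw [h, Ideal.mem_bot] at this
    exact hx0 this
  by_contra hcon
  push Not at hcon
  -- a uniform denominator `s ∉ 𝔭`, `s 𝔲 ⊆ 𝔞`
  obtain ⟨s, hs𝔭, hs⟩ := exists_mul_locP_le hprime (Ideal.ofList Es)
  have hsq : s ∉ q := fun h => hs𝔭 (hq𝔭 h)
  -- elements of the other components outside `𝔮`
  have hex : ∀ Q' ∈ t.erase Q, ∃ y ∉ q, y ∈ Q' := by
    intro Q' hQ'
    obtain ⟨hne, hQ't⟩ := Finset.mem_erase.mp hQ'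
    obtain ⟨x, hx, hxnot⟩ :=
      Set.not_subset.mp (not_radical_le_radical_of_isUnmixedOfRank hunm ht hQ hQ't hne)
    obtain ⟨n, hn⟩ := hx
    exact ⟨x ^ n, fun h => hxnot (hqprime.mem_of_pow_mem n h), hn⟩
  choose! y hy using hex
  set H := s * ∏ Q' ∈ t.erase Q, y Q' with hH
  have hHq : H ∉ q := by
    intro hmem
    rcases hqprime.mem_or_mem hmem with h | h
    · exact hsq h
    · obtain ⟨Q', hQ', h'⟩ := Ideal.IsPrime.prod_mem_iff.mp h
      exact (hy Q' hQ').1 h'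
  have hGH : ∀ G ∈ q, G ^ primaryExponent Q * H ∈ Ideal.ofList Es := by
    intro G hG
    have hGk : G ^ primaryExponent Q ∈ Q :=
      radical_pow_primaryExponent_le Q (Ideal.pow_mem_pow hG _)
    have hmem : G ^ primaryExponent Q * ∏ Q' ∈ t.erase Q, y Q' ∈ locP 𝔭 hprime (Ideal.ofList Es) := by
      rw [← ht.inf_eq, Submodule.mem_finsetInf]
      intro Q' hQ't
      by_cases hQQ : Q' = Q
      · subst hQQ
        exact Ideal.mul_mem_right _ _ hGk
      · have hQ' : Q' ∈ t.erase Q := Finset.mem_erase.mpr ⟨hQQ, hQ't⟩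
        rw [← Finset.mul_prod_erase _ _ hQ']
        exact Ideal.mul_mem_left _ _ (Ideal.mul_mem_right _ _ (hy Q' hQ').2)
    have h := hs _ hmem
    have e : G ^ primaryExponent Q * H = s * (G ^ primaryExponent Q * ∏ Q' ∈ t.erase Q, y Q') := by
      rw [hH]; ring
    rw [e]
    exact h
  -- `T^l 𝔞 ⊆ 𝔮`
  have h𝔞 : ∀ x ∈ Ideal.ofList Es, (homT ℚ)^[primaryExponent Q] x ∈ q := by
    intro x hx
    refine NesterenkoCh10.iterate_apply_mem_of_span (homT ℚ) (S := {x | x ∈ Es})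
      (fun g hg k hk => hcon g hg k (hk.trans (hK Q hQ))) x hx _ le_rfl
  have hT : ∀ G ∈ q, homT ℚ G ∈ q := fun G hG =>
    NesterenkoCh10.apply_mem_of_forall_pow_mul_mem (homT ℚ) hqprime
      (NesterenkoCh10.natCast_factorial_notMem hqprime.ne_top _) h𝔞 hHq hGH hG
  exact not_homTStable_of_deep hr1 hr4 hprime hhom hunm𝔭 hdeep hqhom hqne hq𝔭 hT

end TStep

/-! ### Arithmetic of the constants `a_n = λ^{2^{n+2}−4}`, `b_n = λ^{2^{n+1}−1}`, `c_n = λ^{2^{n+1}−2}` -/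

section Constants

/-- `M^A X + 2 M^B ≤ M^C X` when `A, B ≤ D < C`, `M ≥ 3`, `X ≥ 1`. (Arithmetic of (63).) [folklore] -/
theorem pow_mul_add_two_mul_pow_le {M A B D C X : ℕ} (hM : 3 ≤ M) (hX : 1 ≤ X) (hA : A ≤ D)
    (hB : B ≤ D) (hC : D + 1 ≤ C) : M ^ A * X + 2 * M ^ B ≤ M ^ C * X := by
  have hM1 : 1 ≤ M := by omega
  have h1 : M ^ A * X ≤ M ^ D * X := Nat.mul_le_mul_right _ (Nat.pow_le_pow_right hM1 hA)
  have h2 : M ^ B ≤ M ^ D * X :=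
    (Nat.pow_le_pow_right hM1 hB).trans (Nat.le_mul_of_pos_right _ hX)
  calc M ^ A * X + 2 * M ^ B ≤ M ^ D * X + 2 * (M ^ D * X) := Nat.add_le_add h1 (Nat.mul_le_mul_left 2 h2)
    _ = 3 * (M ^ D * X) := by ring
    _ ≤ M * (M ^ D * X) := Nat.mul_le_mul_right _ hM
    _ = M ^ (D + 1) * X := by ring
    _ ≤ M ^ C * X := Nat.mul_le_mul_right _ (Nat.pow_le_pow_right hM1 hC)

/-- `2 ≤ 2^{n+1}`, `2^{n+2} = 2·2^{n+1}`, `2^{n+3} = 4·2^{n+1}`. [folklore] -/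
theorem two_pow_facts (n : ℕ) : 2 ≤ 2 ^ (n + 1) ∧ 2 ^ (n + 2) = 2 * 2 ^ (n + 1) ∧ 2 ^ (n + 3) = 4 * 2 ^ (n + 1) := by
  refine ⟨?_, by ring, by ring⟩
  calc 2 = 2 ^ 1 := by norm_num
    _ ≤ 2 ^ (n + 1) := Nat.pow_le_pow_right (by norm_num) (by omega)

end Constants

/-! ### The avoidance property along the chain -/

section AvoidBelow

variable {R : Type*} [CommRing R]

/-- Appending an element outside the minimal primes `⊆ 𝔭` of `(C)` preserves the avoidance
property relative to `𝔭`. [folklore] -/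
theorem avoidsBelow_append_singleton {𝔭 : Ideal R} {C : List R} {y : R}
    (hav : ∀ (L₁ : List R) (q : R) (L₂ : List R), C = L₁ ++ q :: L₂ →
      ∀ 𝔭' ∈ (Ideal.ofList L₁).minimalPrimes, 𝔭' ≤ 𝔭 → q ∉ 𝔭')
    (hy : ∀ P ∈ (Ideal.ofList C).minimalPrimes, P ≤ 𝔭 → y ∉ P) :
    ∀ (L₁ : List R) (q : R) (L₂ : List R), C ++ [y] = L₁ ++ q :: L₂ →
      ∀ 𝔭' ∈ (Ideal.ofList L₁).minimalPrimes, 𝔭' ≤ 𝔭 → q ∉ 𝔭' := by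
  intro L₁ q L₂ hdec P hP hP𝔭
  rcases List.append_eq_append_iff.mp hdec with ⟨a', hL₁, h2⟩ | ⟨c', hC, h2⟩
  · cases a' with
    | nil =>
      simp only [List.nil_append, List.cons.injEq] at h2
      obtain ⟨rfl, -⟩ := h2
      rw [List.append_nil] at hL₁
      subst hL₁
      exact hy P hP hP𝔭
    | cons z a'' => simp at h2
  · cases c' with
    | nil =>
      simp only [List.nil_append, List.cons.injEq] at h2
      obtain ⟨rfl, -⟩ := h2
      rw [List.append_nil] at hC
      subst hC
      exact hy P hP hP𝔭
    | cons z c'' =>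
      simp only [List.cons_append, List.cons.injEq] at h2
      obtain ⟨hqz, -⟩ := h2
      rw [hqz]
      exact hav L₁ z c'' hC P hP hP𝔭

/-- The avoidance property of a singleton `[E]` in a domain: `E ≠ 0`. [folklore] -/
theorem avoidsBelow_singleton [IsDomain R] {𝔭 : Ideal R} {E : R} (hE0 : E ≠ 0) :
    ∀ (L₁ : List R) (q : R) (L₂ : List R), [E] = L₁ ++ q :: L₂ →
      ∀ 𝔭' ∈ (Ideal.ofList L₁).minimalPrimes, 𝔭' ≤ 𝔭 → q ∉ 𝔭' := by
  intro L₁ q L₂ hdec P hP _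
  cases L₁ with
  | nil =>
    simp only [List.nil_append, List.cons.injEq] at hdec
    obtain ⟨rfl, -⟩ := hdec
    have hbot : Ideal.ofList ([] : List R) = ⊥ := by simp [Ideal.ofList]
    rw [hbot, Ideal.minimalPrimes_eq_subsingleton_self] at hP
    rw [Set.mem_singleton_iff] at hP
    rw [hP, Ideal.mem_bot]
    exact hE0
  | cons z L => simp at hdec

end AvoidBelow

end Transfer

end Literature.Barriers.Schanuel

end
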